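import Summits.BirchSwinnertonDyer.Rank1Residual.X2.TamagawaSqueeze
import HarnessLib

/-!
# Class X2 (odd multiplicative Eisenstein prime): ROUTE T at `p ‖ N` — rank-`0` `BSD(E,p)` and the
# sub-cell forms (cell `b2b-bsdres`, unit `b2b-bsdres-eisenstein-p2`, gen 6)

HONEST FRAMING (run/shared/lean/b2b/bsd-rank1-residual/, verbatim in every file): the goal of the
cell is to DELETE the COMBINATION-SHAPED residual classes of the Birch–Swinnerton-Dyer formula for
ALL analytic-rank `≤ 1` elliptic curves over `ℚ` — "full BSD formula for every rank `≤ 1` curve in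
class `C`" assembled STRICTLY from published theorems — so that the rank-`≤ 1` remainder becomes
exactly the CONSTRUCTION-SHAPED classes, which are TYPED (missing-input `Prop`s), NOT attempted.
This is not "finishing BSD". Research routes; NO CLAIM BEYOND STATED CLASSES; nothing here changes
a label; X2b and X2c stay CONSTRUCTION-SHAPED. Theorems only (no definition, no named fact).

Companion of `X2/TamagawaSqueeze.lean` (route T at `p ‖ N`: `μ_an = 0 ∧ λ_an = n ∧ λ_alg ≥ k`,
`n ≤ k + e` — or `n ≤ k + e + 1` with the parity `n ≡ r_an + e (mod 2)` — ⇒ Mazur's main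
conjecture at `(E,p)`, `mazurMainConjectureAt_of_algebraicLambdaGE(_of_parity)`):
* rank `0`: `bsdp_of_algebraicLambdaGE_rankZero`, `bsdp_of_algebraicLambdaGE_of_parity_rankZero`
  (`BSD(E,p)` through gen 1's `bsdp_of_mazurMainConjectureAt_of_analyticRank_eq_zero`);
* sub-cell X2b (the typed missing input `X2.MissingInputB W p`):
  `missingInputB_of_cellB_of_algebraicLambdaGE(_of_parity)`;
* sub-cell X2c (rank `1`): `cellC_mazurMainConjectureAt_of_algebraicLambdaGE` — CYCLOTOMIC
  main-conjecture instances at multiplicative Eisenstein primes in rank one at ANY λ-excess;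
  `BSD(E,p)` there is NOT claimed from route T (it needs the regulator valuation,
  `X2/RankOneRegulatorBSD.lean`, or lever L3).
The per-pair lower bound `AlgebraicLambdaGE W p k` is a TYPED input (sub-cell `eisenstein-p1`,
`X1/TamagawaSqueeze.lean`); its source in print is Greenberg's Cor. 5.6 mechanism over the
cyclotomic tower with the local kernel at `p` read off LNM 1716 pp. 91–93 (split: cyclic of order
`∼ log_p(q_E)/2p`; non-split, `p` odd: trivial) — see the module docstring of the companion file.
Nothing booked; candidates for the referee.

References: [GreenbergLNM1716] Prop. 3.10, pp. 91–93, Cor. 5.6 (p. 136); [Wuthrich2014] Thm. 16;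
[SteinWuthrich2013] Thm. 6.1; HOME/b2b-bsdres-eisenstein-p2/X2-GAP.md §11.
-/

set_option autoImplicit false

noncomputable section

open scoped Classical MatrixGroups ModularForm

open PowerSeries CongruenceSubgroup WeierstrassCurve Literature.NumberTheory.EllipticCurves
  Literature.NumberTheory.EllipticCurves.ModularForms
  Literature.NumberTheory.EllipticCurves.Rank1Residual
  Literature.NumberTheory.EllipticCurves.Rank1Residual.Typed
  Literature.NumberTheory.EllipticCurves.Wuthrich2014
  Literature.NumberTheory.EllipticCurves.SteinWuthrich2013
  Literature.NumberTheory.EllipticCurves.Greenberg1999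
  Summit.BirchSwinnertonDyer.Rank1Residual.X1.MuLambda
  Summit.BirchSwinnertonDyer.Rank1Residual.X1.MuPart
  Summit.BirchSwinnertonDyer.Rank1Residual.X1.ParitySqueeze
  Summit.BirchSwinnertonDyer.Rank1Residual.X1.TamagawaSqueeze

namespace Summit.BirchSwinnertonDyer.Rank1Residual.X2

section Forms

variable {W : WeierstrassCurve ℚ} [W.IsElliptic] [W.IsGloballyMinimal] {p : ℕ} [Fact p.Prime]


/-- **Route T, rank `0`: `μ_an = 0 ∧ λ_an = n ∧ λ_alg ≥ k ∧ n ≤ k + e ⇒ BSD(E,p)`** at an odd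
multiplicative Eisenstein prime (through gen 1's `bsdp_of_mazurMainConjectureAt_of_analyticRank_eq_zero`;
Stein–Wuthrich Thm. 6.1 `hJs hJn hHs hHn`, GZK, modularity `hmod hpar`, Greenberg–Stevens `hGS`).
[cite: Wuthrich2014, Thm. 16 (p. 397)] [cite: GreenbergLNM1716, Cor. 5.6 (proof, p. 136)]
[cite: SteinWuthrich2013, Thm. 6.1 (p. 20)] -/
theorem bsdp_of_algebraicLambdaGE_rankZero
    (hWu : thm16_charIdeal_dvd_multiplicative_of_reducible)
    (hJs : thm61_splitMultiplicative) (hJn : thm61_nonsplitMultiplicative)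
    (hHs : exists_isSplitMultCanonical) (hHn : exists_isMultCanonical)
    (hGZK : rank_eq_analyticRank_of_analyticRank_le_one) (hmod : hasEntireLFunction_rat)
    (hpar : nonempty_modularParametrizationData)
    (W : WeierstrassCurve ℚ) [W.IsElliptic] [W.IsGloballyMinimal] (p : ℕ) [Fact p.Prime]
    (hGS : greenberg_stevens (W := W) (p := p))
    (hp2 : p ≠ 2) (hmult : W.HasMultiplicativeReductionAtPrime p)
    (hred : ¬ W.HasIrreducibleModPGaloisRep p) (hr : W.analyticRank = 0) {n k : ℕ}
    (hμ0 : AnalyticMuLE W p 0) (hlam : AnalyticLambdaEq W p n) (halg : AlgebraicLambdaGE W p k)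
    (hkN : ¬ W.HasSplitMultiplicativeReductionAtPrime p → n ≤ k)
    (hkS : W.HasSplitMultiplicativeReductionAtPrime p → n ≤ k + 1) : BSDp W p :=
  bsdp_of_mazurMainConjectureAt_of_analyticRank_eq_zero hJs hJn hHs hHn hGZK hmod hpar W p hGS hp2
    hmult hr (mazurMainConjectureAt_of_algebraicLambdaGE hWu W p hp2 hmult hred hμ0 hlam halg hkN hkS)

/-- **Route T with parity, rank `0`: `BSD(E,p)`** from `μ_an = 0`, `λ_an = n`, `λ_alg ≥ k`,
`n ≤ k + e + 1`, `n ≡ e (mod 2)`. [cite: GreenbergLNM1716, Prop. 3.10 and Cor. 5.6 (proof, p. 136)]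
[cite: Wuthrich2014, Thm. 16 (p. 397)] [cite: SteinWuthrich2013, Thm. 6.1 (p. 20)] -/
theorem bsdp_of_algebraicLambdaGE_of_parity_rankZero
    (hWu : thm16_charIdeal_dvd_multiplicative_of_reducible)
    (hJs : thm61_splitMultiplicative) (hJn : thm61_nonsplitMultiplicative)
    (hHs : exists_isSplitMultCanonical) (hHn : exists_isMultCanonical)
    (h310 : prop310_selmerCorank_mod_two_eq_lambdaInvariant)
    (hGZK : rank_eq_analyticRank_of_analyticRank_le_one) (hmod : hasEntireLFunction_rat)
    (hpar : nonempty_modularParametrizationData)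
    (W : WeierstrassCurve ℚ) [W.IsElliptic] [W.IsGloballyMinimal] (p : ℕ) [Fact p.Prime]
    (hGS : greenberg_stevens (W := W) (p := p))
    (hp2 : p ≠ 2) (hmult : W.HasMultiplicativeReductionAtPrime p)
    (hred : ¬ W.HasIrreducibleModPGaloisRep p) (hr : W.analyticRank = 0) {n k : ℕ}
    (hμ0 : AnalyticMuLE W p 0) (hlam : AnalyticLambdaEq W p n) (halg : AlgebraicLambdaGE W p k)
    (hkN : ¬ W.HasSplitMultiplicativeReductionAtPrime p → n ≤ k + 1 ∧ Even n)
    (hkS : W.HasSplitMultiplicativeReductionAtPrime p → n ≤ k + 2 ∧ Odd n) : BSDp W p :=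
  bsdp_of_mazurMainConjectureAt_of_analyticRank_eq_zero hJs hJn hHs hHn hGZK hmod hpar W p hGS hp2
    hmult hr
    (mazurMainConjectureAt_of_algebraicLambdaGE_of_parity hWu h310 hGZK W p hp2 hmult hred (by omega)
      hμ0 hlam halg (fun hns ↦ by rw [hr, add_zero]; exact hkN hns)
      (fun hs ↦ by rw [hr, add_zero]; exact hkS hs))

/-- **Sub-cell X2b: the typed missing input `X2.MissingInputB W p`** from `μ_an = 0`, `λ_an = n`,
`λ_alg ≥ k`, `n ≤ k + e` (no parity). [cite: Wuthrich2014, Thm. 16 (p. 397)] [cite: GreenbergLNM1716, Cor. 5.6 (proof, p. 136)] -/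
theorem missingInputB_of_cellB_of_algebraicLambdaGE
    (hWu : thm16_charIdeal_dvd_multiplicative_of_reducible)
    (W : WeierstrassCurve ℚ) [W.IsElliptic] [W.IsGloballyMinimal] (p : ℕ) [Fact p.Prime]
    (hc : CellB W p) {n k : ℕ} (hμ0 : AnalyticMuLE W p 0) (hlam : AnalyticLambdaEq W p n)
    (halg : AlgebraicLambdaGE W p k)
    (hkN : ¬ W.HasSplitMultiplicativeReductionAtPrime p → n ≤ k)
    (hkS : W.HasSplitMultiplicativeReductionAtPrime p → n ≤ k + 1) : MissingInputB W p :=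
  mazurMainConjectureAt_of_algebraicLambdaGE hWu W p hc.2.1.1 hc.2.1.2.2 hc.2.1.2.1 hμ0 hlam halg
    hkN hkS

/-- **Sub-cell X2b with parity: `X2.MissingInputB W p`** from `μ_an = 0`, `λ_an = n`, `λ_alg ≥ k`,
`n ≤ k + e + 1`, `n ≡ e (mod 2)` (rank `0`). [cite: GreenbergLNM1716, Prop. 3.10 and Cor. 5.6 (proof, p. 136)]
[cite: Wuthrich2014, Thm. 16 (p. 397)] -/
theorem missingInputB_of_cellB_of_algebraicLambdaGE_of_parity
    (hWu : thm16_charIdeal_dvd_multiplicative_of_reducible)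
    (h310 : prop310_selmerCorank_mod_two_eq_lambdaInvariant)
    (hGZK : rank_eq_analyticRank_of_analyticRank_le_one)
    (W : WeierstrassCurve ℚ) [W.IsElliptic] [W.IsGloballyMinimal] (p : ℕ) [Fact p.Prime]
    (hc : CellB W p) {n k : ℕ} (hμ0 : AnalyticMuLE W p 0) (hlam : AnalyticLambdaEq W p n)
    (halg : AlgebraicLambdaGE W p k)
    (hkN : ¬ W.HasSplitMultiplicativeReductionAtPrime p → n ≤ k + 1 ∧ Even n)
    (hkS : W.HasSplitMultiplicativeReductionAtPrime p → n ≤ k + 2 ∧ Odd n) : MissingInputB W p :=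
  mazurMainConjectureAt_of_algebraicLambdaGE_of_parity hWu h310 hGZK W p hc.2.1.1 hc.2.1.2.2
    hc.2.1.2.1 (by rw [hc.1]; omega) hμ0 hlam halg
    (fun hns ↦ by rw [hc.1, add_zero]; exact hkN hns) (fun hs ↦ by rw [hc.1, add_zero]; exact hkS hs)

/-- **Sub-cell X2c (rank `1`): the CYCLOTOMIC main conjecture at the pair** from `μ_an = 0`,
`λ_an = n`, `λ_alg ≥ k`, `n ≤ k + e + 1` and `n ≡ 1 + e (mod 2)` — main-conjecture instances at
multiplicative Eisenstein primes in rank one at ANY λ-excess; `BSD(E,p)` there is NOT claimed from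
these data (it needs the regulator valuation, `X2/RankOneRegulatorBSD.lean`).
[cite: GreenbergLNM1716, Prop. 3.10 and Cor. 5.6 (proof, p. 136)] [cite: Wuthrich2014, Thm. 16 (p. 397)] -/
theorem cellC_mazurMainConjectureAt_of_algebraicLambdaGE
    (hWu : thm16_charIdeal_dvd_multiplicative_of_reducible)
    (h310 : prop310_selmerCorank_mod_two_eq_lambdaInvariant)
    (hGZK : rank_eq_analyticRank_of_analyticRank_le_one)
    (W : WeierstrassCurve ℚ) [W.IsElliptic] [W.IsGloballyMinimal] (p : ℕ) [Fact p.Prime]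
    (hc : CellC W p) {n k : ℕ} (hμ0 : AnalyticMuLE W p 0) (hlam : AnalyticLambdaEq W p n)
    (halg : AlgebraicLambdaGE W p k)
    (hkN : ¬ W.HasSplitMultiplicativeReductionAtPrime p → n ≤ k + 1 ∧ Odd n)
    (hkS : W.HasSplitMultiplicativeReductionAtPrime p → n ≤ k + 2 ∧ Even n) :
    X2.MazurMainConjectureAt W p :=
  mazurMainConjectureAt_of_algebraicLambdaGE_of_parity hWu h310 hGZK W p hc.2.1 hc.2.2.2 hc.2.2.1
    (by rw [hc.1]) hμ0 hlam halg
    (fun hns ↦ by rw [hc.1]; exact ⟨(hkN hns).1, (hkN hns).2.add_one⟩)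
    (fun hs ↦ by rw [hc.1]; exact ⟨(hkS hs).1, (hkS hs).2.add_one⟩)

end Forms

end Summit.BirchSwinnertonDyer.Rank1Residual.X2

end
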